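import Mathlib.MeasureTheory.Integral.IntervalIntegral.Basic
import Mathlib.FieldTheory.Normal.Defs
import Mathlib.FieldTheory.IntermediateField.Adjoin.Basic
import Mathlib.FieldTheory.IntermediateField.Algebraic
import Mathlib.FieldTheory.Normal.Closure
import Mathlib.RingTheory.IntegralClosure.IsIntegralClosure.Basic
import Literature.NumberTheory.GaloisRepresentations.IntegralGaloisAction
import Literature.NumberTheory.GaloisRepresentations.LocalGaloisGroup
import HarnessLib

-- provenance: harness21/H21/H21/Prelude/GalRep/RamificationFiltration.lean @ c2961f6 (interim HEAD d8f2665); M5 mechanical rewrite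
/-!
# Higher ramification groups and the Herbrand functions (trunk GalRep, item C9)

Finite level.  Let a group `G` act on a commutative ring `S` by ring automorphisms and let
`𝔓 : Ideal S`.  The *lower-numbering ramification groups* are
`G_i = {σ ∈ D_𝔓 | ∀ x, σ • x ≡ x (mod 𝔓 ^ (i+1))}` (`i : ℕ`), so `G_0 = I_𝔓` is Mathlib's
inertia group `Ideal.inertia`.  We define
`Ideal.ramificationSubgroup 𝔓 G i := 𝔓.decompositionSubgroup G ⊓ (𝔓 ^ (i+1)).inertia G`,
the Herbrand function `φ(u) = ∫₀ᵘ dt / (G₀ : G_{⌈t⌉})`, its inverse `ψ`, and the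
*upper-numbering* groups `G^v = G_{⌈ψ v⌉}`.

Absolute level.  For a field `K`, a commutative ring `R` with `[Algebra R K]` and an ideal `𝔓`
of `absIntegers R K = integralClosure R K̄`, the upper-numbering filtration on
`Γ_K = Field.absoluteGaloisGroup K` is defined, following Serre, as the intersection over all
finite normal subextensions `E/K` of `K̄` of the pull-backs of the finite-level groups
`Gal(E/K)^v` at the prime `𝔓 ∩ E`; the transition maps are Mathlib's
`AlgEquiv.restrictNormalHom E` and the (genuinely defined, sorry-free) inclusion
`IntermediateField.integralClosureToAbsIntegers R E : integralClosure R E →ₐ[R] absIntegers R K`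
(Mathlib's `AlgHom.mapIntegralClosure` applied to `E.val`).  For a non-archimedean local field
`F` we abbreviate `absUpperInertia F v` (`𝔓 = absMaximalIdeal F`, item C4); `v = 0` recovers
the inertia group `absInertia F` (`absUpperRamificationSubgroup_zero_eq_inertia`, sorried), and
these groups feed the Swan/Artin conductor (item C10).

Mathlib search.  Mathlib has `Ideal.inertia`, `MulAction.stabilizer`,
`ValuationSubring.decompositionSubgroup` / `inertiaSubgroup`
(`Mathlib/RingTheory/Valuation/RamificationGroup.lean`, whose module docstring lists
"higher ramification groups in lower numbering" as a TODO), `Ideal.ramificationIdx`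
(ramification *index*), `AlgEquiv.restrictNormalHom`, `AlgHom.mapIntegralClosure`,
`intervalIntegral`; it has no higher ramification groups, Herbrand functions or upper
numbering (grep for `ramification`, `Herbrand`, `upperNumbering`, `lowerNumbering`).  Nothing
here duplicates a Mathlib declaration.

Sources: J.-P. Serre, *Local Fields* (Corps Locaux, 1962/1979), Ch. IV §1 (ramification
groups `G_i`, Prop. 1–3), §3 (the functions `φ`, `ψ`, Herbrand's theorem, upper numbering,
Prop. 12–14, Remark 1: `G^v` for infinite extensions); J. Neukirch, *Algebraic Number Theory*
(1999), Ch. II §10; P. Deligne, *Les constantes des équations fonctionnelles des fonctions L*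
(Antwerp II, 1973), §2 (absolute upper filtration).

Design choices.
* `Ideal.ramificationSubgroup` and its lemmas are deliberately declared in Mathlib's `Ideal`
  namespace, for dot notation `𝔓.ramificationSubgroup G i` parallel to `𝔓.inertia G` and
  `𝔓.decompositionSubgroup G` (item C3); likewise `IntermediateField.integralClosureToAbsIntegers`
  in Mathlib's `IntermediateField` namespace (dot notation `E.integralClosureToAbsIntegers R`).
  Mathlib has no declarations with these names.  Everything else is in `namespace Literature`.
* Indexing: `ramificationSubgroup 𝔓 G i` is Serre's `G_i` for `i : ℕ` (`G_{-1} = D_𝔓` is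
  `𝔓.decompositionSubgroup G`).  The intersection with `D_𝔓` is needed because for a general
  ring `S` the inertia group of `𝔓 ^ (i+1)` need not stabilise `𝔓`.
* `herbrandPhi 𝔓 G u = ∫ t in 0..u, ((#G_0 : ℝ) / #G_{⌈t⌉₊})⁻¹`.  For `t ≤ 0` we have `⌈t⌉₊ = 0`
  and the integrand is `1`, so `herbrandPhi 𝔓 G u = u` for all `u ≤ 0`: this agrees with Serre's
  `φ` on `[-1, 0]` (where `G_u = G_0`) and extends it by the identity below `-1` (where Serre
  leaves `φ` undefined).  Junk value: if `G_0` is infinite then `Nat.card G_0 = 0` and the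
  integrand is `0⁻¹ = 0`, so `φ = 0`; all theorems assume `[Finite G]`.
* `herbrandPsi` is the order-theoretic inverse `sSup {u | φ u ≤ v}` (a real number by the junk
  conventions of `sSup` on `ℝ` when the set is empty or unbounded; for finite `G` the set is
  `(-∞, ψ v]`).  Non-integral upper/lower indices are rounded *up* (`⌈·⌉₊`), matching Serre's
  convention `G_u = G_{⌈u⌉}` (IV §3, before Prop. 12).
* Absolute level (review 13 of the outline): the inclusion
  `integralClosure R E → absIntegers R K` is real data with a real proof, and its equivariance
  along `AlgEquiv.restrictNormalHom E` is proved (`integralClosureToAbsIntegers_restrictNormalHom_smul`).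
  Since `Field.absoluteGaloisGroup K` is a non-reducible `def`, `restrictNormalHom E` is
  precomposed with the identity isomorphism `Field.absoluteGaloisGroup.toAlgEquiv K` (item C2).
-/

noncomputable section

open scoped Pointwise
open MeasureTheory

/-! ### Lower-numbering ramification groups (Mathlib `Ideal` namespace, dot notation) -/

namespace Ideal

section Lower

variable {S : Type*} [CommRing S] (𝔓 : Ideal S) (G : Type*) [Group G] [MulSemiringAction G S]

/-- The `i`-th *ramification group in the lower numbering* (`i : ℕ`) of the ideal `𝔓` of `S`
under a group `G` acting on `S` by ring automorphisms:
`G_i = {σ ∈ D_𝔓 | ∀ x, σ • x - x ∈ 𝔓 ^ (i+1)} = D_𝔓 ⊓ I_{𝔓^(i+1)}`, where `D_𝔓` is the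
decomposition group (`Ideal.decompositionSubgroup`, item C3) and `I_•` is Mathlib's
`Ideal.inertia`.  Thus `G_0 = I_𝔓` (`ramificationSubgroup_zero`) and `G_{-1} = D_𝔓` is not
part of this `ℕ`-indexed family.  Declared in Mathlib's `Ideal` namespace for dot notation.
Ref: Serre, *Local Fields*, Ch. IV §1, definition before Prop. 1. [folklore] -/
def ramificationSubgroup (i : ℕ) : Subgroup G :=
  𝔓.decompositionSubgroup G ⊓ (𝔓 ^ (i + 1)).inertia G

variable {𝔓 G} in
/-- Membership in `G_i`: `σ` stabilises `𝔓` and `σ • x ≡ x (mod 𝔓 ^ (i+1))` for all `x`.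
Ref: Serre, *Local Fields*, Ch. IV §1, Lemma 1. [folklore] -/
theorem mem_ramificationSubgroup_iff {σ : G} {i : ℕ} :
    σ ∈ 𝔓.ramificationSubgroup G i ↔ σ • 𝔓 = 𝔓 ∧ ∀ x : S, σ • x - x ∈ 𝔓 ^ (i + 1) :=
  Iff.rfl

/-- `G_0` is the inertia group `I_𝔓` (Mathlib's `Ideal.inertia`; uses
`Ideal.inertia_le_stabilizer`).  Ref: Serre, *Local Fields*, Ch. IV §1, before Prop. 1. [folklore] -/
@[simp]
theorem ramificationSubgroup_zero : 𝔓.ramificationSubgroup G 0 = 𝔓.inertia G := by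
  rw [ramificationSubgroup, zero_add, pow_one]
  exact inf_eq_right.mpr 𝔓.inertia_le_stabilizer

/-- The ramification groups are contained in the decomposition group.
Ref: Serre, *Local Fields*, Ch. IV §1. [folklore] -/
theorem ramificationSubgroup_le_decompositionSubgroup (i : ℕ) :
    𝔓.ramificationSubgroup G i ≤ 𝔓.decompositionSubgroup G :=
  inf_le_left

/-- The ramification groups are contained in the inertia group: `G_i ≤ G_0 = I_𝔓`.
Ref: Serre, *Local Fields*, Ch. IV §1, Prop. 1. [folklore] -/
theorem ramificationSubgroup_le_inertia (i : ℕ) : 𝔓.ramificationSubgroup G i ≤ 𝔓.inertia G :=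
  fun _ hσ x => Ideal.pow_le_self (Nat.succ_ne_zero i) (hσ.2 x)

/-- The lower-numbering filtration is decreasing: `i ≤ j → G_j ≤ G_i`.
Ref: Serre, *Local Fields*, Ch. IV §1, Prop. 1. [folklore] -/
theorem ramificationSubgroup_antitone : Antitone (𝔓.ramificationSubgroup G) :=
  fun _ _ hij _ hσ => ⟨hσ.1, fun x => Ideal.pow_le_pow_right (Nat.succ_le_succ hij) (hσ.2 x)⟩

/-- The ramification groups `G_i` are normal in the decomposition group; here stated as:
`G_i` is normalised by `D_𝔓`.  Ref: Serre, *Local Fields*, Ch. IV §1, Prop. 1. [folklore] -/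
theorem ramificationSubgroup_conj_mem {σ τ : G} {i : ℕ} (hσ : σ ∈ 𝔓.ramificationSubgroup G i)
    (hτ : τ ∈ 𝔓.decompositionSubgroup G) : τ * σ * τ⁻¹ ∈ 𝔓.ramificationSubgroup G i := by
  refine ⟨Subgroup.mul_mem _ (Subgroup.mul_mem _ hτ hσ.1) (Subgroup.inv_mem _ hτ), fun x => ?_⟩
  have hτ' : τ • 𝔓 ^ (i + 1) = 𝔓 ^ (i + 1) := by
    rw [smul_pow', Ideal.mem_decompositionSubgroup_iff.mp hτ]
  have h : τ • (σ • τ⁻¹ • x - τ⁻¹ • x) ∈ τ • 𝔓 ^ (i + 1) :=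
    Ideal.smul_mem_pointwise_smul _ _ _ (hσ.2 (τ⁻¹ • x))
  rwa [hτ', smul_sub, smul_inv_smul, ← mul_smul, ← mul_smul] at h

/-- For a finite group acting faithfully on a Noetherian domain `S` and a proper ideal `𝔓`,
the ramification groups are eventually trivial: `G_i = 1` for `i ≫ 0` (an element of `⋂ G_i`
moves every `x` into `⋂ₙ 𝔓 ^ n = 0` by Krull's intersection theorem, hence acts trivially).
Ref: Serre, *Local Fields*, Ch. IV §1, Prop. 1 and its proof. [cite: SerreLocalFields1979, Ch. IV §1 Prop. 1 (and its proof)] -/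
def ramificationSubgroup_eventually_eq_bot : Prop :=
  ∀ [IsDomain S] [IsNoetherianRing S] [Finite G] [FaithfulSMul G S] (h𝔓 : 𝔓 ≠ ⊤),
    ∃ N : ℕ, ∀ i, N ≤ i → 𝔓.ramificationSubgroup G i = ⊥

end Lower

end Ideal

namespace Literature.NumberTheory.GaloisRepresentations

/-! ### The Herbrand functions `φ`, `ψ` and the upper numbering (finite level) -/

section Herbrand

variable {S : Type*} [CommRing S] (𝔓 : Ideal S) (G : Type*) [Group G] [MulSemiringAction G S]

/-- The integrand `1 / (G_0 : G_{⌈t⌉₊}) = ((#G_0 : ℝ) / #G_{⌈t⌉₊})⁻¹` of the Herbrand function.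
It equals `1` for `t ≤ 0` and `#G_i / #G_0` on `(i-1, i]`, `i ≥ 1`.  Junk: `0` if `G_0` is
infinite.  Ref: Serre, *Local Fields*, Ch. IV §3, definition of `φ`. [folklore] -/
def herbrandIntegrand (t : ℝ) : ℝ :=
  ((Nat.card (𝔓.ramificationSubgroup G 0) : ℝ) / Nat.card (𝔓.ramificationSubgroup G ⌈t⌉₊))⁻¹

/-- The *Herbrand function* `φ = φ_{L/K}` of the ramification filtration of `𝔓`:
`herbrandPhi 𝔓 G u = ∫ t in 0..u, dt / (G_0 : G_{⌈t⌉₊})`.  For `u ≤ 0` this is `u`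
(`herbrandPhi_of_nonpos`), agreeing with Serre's `φ` on `[-1, 0]` and extending it linearly
below `-1`; for `m ≤ u ≤ m + 1` (`m : ℕ`) it is
`(#G_1 + ⋯ + #G_m + (u - m) #G_{m+1}) / #G_0`.
Ref: Serre, *Local Fields*, Ch. IV §3, before Prop. 12. [folklore] -/
def herbrandPhi (u : ℝ) : ℝ :=
  ∫ t in (0 : ℝ)..u, herbrandIntegrand 𝔓 G t

/-- `φ(0) = 0`.  Ref: Serre, *Local Fields*, Ch. IV §3. [folklore] -/
@[simp]
theorem herbrandPhi_zero : herbrandPhi 𝔓 G 0 = 0 :=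
  intervalIntegral.integral_same

variable {G} in
/-- For finite `G` the Herbrand integrand is `1` at every `t ≤ 0` (`⌈t⌉₊ = 0`).
Ref: Serre, *Local Fields*, Ch. IV §3 (`φ(u) = u` for `-1 ≤ u ≤ 0`). [folklore] -/
theorem herbrandIntegrand_of_nonpos [Finite G] {t : ℝ} (ht : t ≤ 0) :
    herbrandIntegrand 𝔓 G t = 1 := by
  rw [herbrandIntegrand, Nat.ceil_eq_zero.mpr ht, div_self, inv_one]
  exact Nat.cast_ne_zero.mpr Nat.card_pos.ne'

variable {G} in
/-- For finite `G` and `u ≤ 0`, `φ(u) = u`: `φ` is the identity on `(-∞, 0]` (Serre: on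
`[-1, 0]`; see the module docstring for the extension below `-1`).
Ref: Serre, *Local Fields*, Ch. IV §3, before Prop. 12. [folklore] -/
theorem herbrandPhi_of_nonpos [Finite G] {u : ℝ} (hu : u ≤ 0) : herbrandPhi 𝔓 G u = u := by
  have h : Set.EqOn (herbrandIntegrand 𝔓 G) (fun _ => (1 : ℝ)) (Set.uIcc 0 u) := by
    intro t ht
    rw [Set.uIcc_of_ge hu] at ht
    exact herbrandIntegrand_of_nonpos 𝔓 ht.2
  rw [herbrandPhi, intervalIntegral.integral_congr h, intervalIntegral.integral_const, smul_eq_mul,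
    mul_one, sub_zero]

/-- `φ` is continuous, piecewise linear, increasing; here: strictly increasing on `[-1, ∞)`
(in fact on all of `ℝ` with our extension), for finite `G` (the integrand
`#G_{⌈t⌉₊} / #G_0` is positive).  Ref: Serre, *Local Fields*, Ch. IV §3, Prop. 12 ff. [cite: SerreLocalFields1979, Ch. IV §3 Prop. 12 ff.] -/
def herbrandPhi_strictMonoOn : Prop :=
  ∀ [Finite G],
    StrictMonoOn (herbrandPhi 𝔓 G) (Set.Ici (-1))

/-- `φ` is continuous (for finite `G`).  Ref: Serre, *Local Fields*, Ch. IV §3, Prop. 12 ff. [cite: SerreLocalFields1979, Ch. IV §3 Prop. 12 ff.] -/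
def continuous_herbrandPhi : Prop :=
  ∀ [Finite G],
    Continuous (herbrandPhi 𝔓 G)

/-- The inverse Herbrand function `ψ = φ⁻¹`, defined order-theoretically as
`herbrandPsi 𝔓 G v = sSup {u | φ u ≤ v}`.  For finite `G`, `φ : ℝ → ℝ` is a strictly increasing
continuous bijection and `ψ` is its inverse (`herbrandPhi_herbrandPsi`); in general the value
is subject to the junk conventions of `sSup` on `ℝ`.
Ref: Serre, *Local Fields*, Ch. IV §3, before Prop. 13. [folklore] -/
def herbrandPsi (v : ℝ) : ℝ :=
  sSup {u : ℝ | herbrandPhi 𝔓 G u ≤ v}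

/-- `φ (ψ v) = v` for finite `G`.  Ref: Serre, *Local Fields*, Ch. IV §3 (`ψ = φ⁻¹`). [cite: SerreLocalFields1979, Ch. IV §3] -/
def herbrandPhi_herbrandPsi : Prop :=
  ∀ [Finite G] (v : ℝ),
    herbrandPhi 𝔓 G (herbrandPsi 𝔓 G v) = v

/-- `ψ (φ u) = u` for finite `G`.  Ref: Serre, *Local Fields*, Ch. IV §3 (`ψ = φ⁻¹`). [cite: SerreLocalFields1979, Ch. IV §3] -/
def herbrandPsi_herbrandPhi : Prop :=
  ∀ [Finite G] (u : ℝ),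
    herbrandPsi 𝔓 G (herbrandPhi 𝔓 G u) = u

/-- `ψ` is monotone (for finite `G`; indeed strictly increasing and continuous).
Ref: Serre, *Local Fields*, Ch. IV §3, before Prop. 13. [cite: SerreLocalFields1979, Ch. IV §3 (before Prop. 13)] -/
def herbrandPsi_monotone : Prop :=
  ∀ [Finite G],
    Monotone (herbrandPsi 𝔓 G)

/-- `ψ(v) = v` for `v ≤ 0` (finite `G`).  Ref: Serre, *Local Fields*, Ch. IV §3. [cite: SerreLocalFields1979, Ch. IV §3] -/
def herbrandPsi_of_nonpos : Prop :=
  ∀ [Finite G] {v : ℝ} (hv : v ≤ 0),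
    herbrandPsi 𝔓 G v = v

/-- The *upper-numbering ramification group* `G^v = G_{ψ(v)}` (`v : ℝ`), with the non-integral
lower index rounded up: `upperRamificationSubgroup 𝔓 G v = G_{⌈ψ v⌉₊}` (Serre's convention
`G_u = G_i` for `i - 1 < u ≤ i`).  For `v ≤ 0` this is `G_0 = I_𝔓`.
Ref: Serre, *Local Fields*, Ch. IV §3, before Prop. 14 ("upper numbering"). [folklore] -/
def upperRamificationSubgroup (v : ℝ) : Subgroup G :=
  𝔓.ramificationSubgroup G ⌈herbrandPsi 𝔓 G v⌉₊

/-- `G^{φ(u)} = G_{⌈u⌉₊}` (finite `G`).  Ref: Serre, *Local Fields*, Ch. IV §3,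
definition of the upper numbering. [folklore] -/
def upperRamificationSubgroup_herbrandPhi : Prop :=
  ∀ [Finite G] (u : ℝ),
    upperRamificationSubgroup 𝔓 G (herbrandPhi 𝔓 G u) = 𝔓.ramificationSubgroup G ⌈u⌉₊

/- interim proof relied on results that are now named facts (D-0014); demoted to a fact by the M5 import, proof preserved:
:= by
  rw [upperRamificationSubgroup, herbrandPsi_herbrandPhi]
-/

/-- The upper-numbering filtration is decreasing (finite `G`).
Ref: Serre, *Local Fields*, Ch. IV §3, Prop. 14 ff. [folklore] -/
def upperRamificationSubgroup_antitone : Prop :=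
  ∀ [Finite G],
    Antitone (upperRamificationSubgroup 𝔓 G)

/- interim proof relied on results that are now named facts (D-0014); demoted to a fact by the M5 import, proof preserved:
:=
  fun _ _ hvw => 𝔓.ramificationSubgroup_antitone G
    (Nat.ceil_le_ceil (herbrandPsi_monotone 𝔓 G hvw))
-/

/-- `G^v = G_0 = I_𝔓` for `v ≤ 0` (finite `G`).  Ref: Serre, *Local Fields*, Ch. IV §3. [folklore] -/
def upperRamificationSubgroup_of_nonpos : Prop :=
  ∀ [Finite G] {v : ℝ} (hv : v ≤ 0),
    upperRamificationSubgroup 𝔓 G v = 𝔓.inertia G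

/- interim proof relied on results that are now named facts (D-0014); demoted to a fact by the M5 import, proof preserved:
:= by
  rw [upperRamificationSubgroup, herbrandPsi_of_nonpos 𝔓 G hv, Nat.ceil_eq_zero.mpr hv,
    Ideal.ramificationSubgroup_zero]
-/

/-- The upper-numbering groups are contained in the inertia group.
Ref: Serre, *Local Fields*, Ch. IV §3. [folklore] -/
theorem upperRamificationSubgroup_le_inertia (v : ℝ) :
    upperRamificationSubgroup 𝔓 G v ≤ 𝔓.inertia G :=
  𝔓.ramificationSubgroup_le_inertia G _

end Herbrand

/-! ### Inclusion of integral closures along an intermediate field; Herbrand's theorem -/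

end Literature.NumberTheory.GaloisRepresentations

namespace IntermediateField

variable (R : Type*) {K L : Type*} [CommRing R] [Field K] [Field L] [Algebra R K] [Algebra R L]
  [Algebra K L] [IsScalarTower R K L] (E : IntermediateField K L)

/-- For an intermediate field `E` of `L/K` (an `R`-algebra through Mathlib's
`IntermediateField.algebra'`), the inclusion `integralClosure R E →ₐ[R] integralClosure R L`
induced by `E.val : E →ₐ[K] L` (Mathlib's `AlgHom.mapIntegralClosure`; integrality is preserved
by `IsIntegral.map`).  Declared in Mathlib's `IntermediateField` namespace for dot notation.
Ref: Serre, *Local Fields*, Ch. I §4 (functoriality of integral closure). [folklore] -/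
def integralClosureInclusion : integralClosure R E →ₐ[R] integralClosure R L :=
  (E.val.restrictScalars R).mapIntegralClosure

/-- The inclusion of integral closures is the identity on underlying elements of `L`.
Ref: Serre, *Local Fields*, Ch. I §4. [folklore] -/
@[simp]
theorem coe_integralClosureInclusion (x : integralClosure R E) :
    ((E.integralClosureInclusion R x : integralClosure R L) : L) = ((x : E) : L) :=
  rfl

/-- The inclusion of integral closures is injective.  Ref: Serre, *Local Fields*, Ch. I §4. [folklore] -/
theorem integralClosureInclusion_injective : Function.Injective (E.integralClosureInclusion R) :=
  fun _ _ h => Subtype.ext (Subtype.ext (congrArg (fun z : integralClosure R L => (z : L)) h))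

/-- Equivariance: for `E/K` normal and `σ ∈ Gal(L/K)`, the inclusion intertwines the action of
`σ` on `integralClosure R L` with that of its restriction `σ|_E = restrictNormalHom E σ` on
`integralClosure R E` (both actions are Mathlib's `MulSemiringAction G (integralClosure R _)`).
Ref: Serre, *Local Fields*, Ch. I §7, Prop. 22 (passage to quotient/subextension). [folklore] -/
theorem integralClosureInclusion_restrictNormalHom_smul [Normal K E] (σ : L ≃ₐ[K] L)
    (x : integralClosure R E) :
    E.integralClosureInclusion R (AlgEquiv.restrictNormalHom E σ • x) =
      σ • E.integralClosureInclusion R x := by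
  refine Subtype.ext ?_
  rw [coe_integralClosureInclusion, integralClosure.coe_smul, integralClosure.coe_smul,
    coe_integralClosureInclusion]
  exact AlgEquiv.restrictNormalHom_apply E σ x

/-- Absolute version: for `E` an intermediate field of `K̄/K`, the inclusion
`integralClosure R E →ₐ[R] absIntegers R K = integralClosure R K̄` (restriction of `E.val`).
This is genuine data (no `sorry`).  Declared in Mathlib's `IntermediateField` namespace for dot
notation `E.integralClosureToAbsIntegers R`.
Ref: Serre, *Local Fields*, Ch. IV §3, Remark 1 (upper numbering for infinite extensions). [folklore] -/
abbrev integralClosureToAbsIntegers (E : IntermediateField K (AlgebraicClosure K)) :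
    integralClosure R E →ₐ[R] Literature.NumberTheory.GaloisRepresentations.absIntegers R K :=
  E.integralClosureInclusion R

/-- Equivariance of `integralClosureToAbsIntegers` for `E/K` normal and `σ ∈ Gal(K̄/K)`:
`ι (σ|_E • x) = σ • ι x`, where `σ|_E = restrictNormalHom E (toAlgEquiv K σ)`.
Ref: Serre, *Local Fields*, Ch. IV §3, Remark 1; Ch. I §7, Prop. 22. [folklore] -/
theorem integralClosureToAbsIntegers_restrictNormalHom_smul
    (E : IntermediateField K (AlgebraicClosure K)) [Normal K E] (σ : Field.absoluteGaloisGroup K)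
    (x : integralClosure R E) :
    E.integralClosureToAbsIntegers R
        (AlgEquiv.restrictNormalHom E (Field.absoluteGaloisGroup.toAlgEquiv K σ) • x) =
      σ • E.integralClosureToAbsIntegers R x :=
  E.integralClosureInclusion_restrictNormalHom_smul R _ x

end IntermediateField

namespace Literature.NumberTheory.GaloisRepresentations

section HerbrandTheorem

variable (R : Type*) {K L : Type*} [CommRing R] [Field K] [Field L] [Algebra R K] [Algebra R L]
  [Algebra K L] [IsScalarTower R K L] (E : IntermediateField K L)

/-- **Herbrand's theorem** (compatibility of the upper numbering with quotients).  Let `R` be a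
Dedekind domain with fraction field `K`, `L/K` finite Galois, `E/K` a normal subextension,
`𝔓` a maximal ideal of `S_L = integralClosure R L` with separable residue extension over `R`,
and `𝔓_E = 𝔓 ∩ E`.  Then for every `v`, `Gal(E/K)^v` (computed at `𝔓_E`) is the image of
`Gal(L/K)^v` (computed at `𝔓`) under restriction: `(G/H)^v = G^v H / H`.
Ref: Serre, *Local Fields*, Ch. IV §3, Prop. 14 and Lemma 5 (Herbrand); Neukirch,
*Algebraic Number Theory*, Ch. II (10.7). [cite: SerreLocalFields1979, Ch. IV §3 Prop. 14 and Lemma 5 (Herbrand)] [cite: NeukirchANT1999, Ch. II (10.7)] -/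
def herbrand_quotient : Prop :=
  ∀ [IsDedekindDomain R] [IsFractionRing R K] [FiniteDimensional K L] [IsGalois K L] [Normal K E] (𝔓 : Ideal (integralClosure R L)) [𝔓.IsMaximal] [Algebra.IsSeparable (R ⧸ 𝔓.under R) (integralClosure R L ⧸ 𝔓)] (v : ℝ),
    upperRamificationSubgroup (𝔓.comap (E.integralClosureInclusion R)) (E ≃ₐ[K] E) v =
      (upperRamificationSubgroup 𝔓 (L ≃ₐ[K] L) v).map (AlgEquiv.restrictNormalHom E)

end HerbrandTheorem

/-! ### The absolute upper-numbering filtration on `Gal(K̄/K)` -/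

section Absolute

open Field

variable (R : Type*) {K : Type*} [CommRing R] [Field K] [Algebra R K]

/-- Restriction `Gal(K̄/K) → Gal(E/K)` for a normal intermediate field `E` of `K̄/K`: Mathlib's
`AlgEquiv.restrictNormalHom E` precomposed with the identity `absoluteGaloisGroup K ≃* (K̄ ≃ₐ[K] K̄)`
(`Field.absoluteGaloisGroup.toAlgEquiv`, item C2).
Ref: Neukirch, *Algebraic Number Theory*, Ch. IV §1. [folklore] -/
abbrev absRestrictNormalHom (E : IntermediateField K (AlgebraicClosure K)) [Normal K E] :
    absoluteGaloisGroup K →* (E ≃ₐ[K] E) :=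
  (AlgEquiv.restrictNormalHom E).comp (absoluteGaloisGroup.toAlgEquiv K).toMonoidHom

/-- The *absolute upper-numbering ramification group* `Γ_K^v ≤ Gal(K̄/K)` at an ideal `𝔓` of
`absIntegers R K`: the intersection, over all finite normal subextensions `E/K` of `K̄`, of the
preimages under restriction of the finite-level groups `Gal(E/K)^v` at `𝔓_E = 𝔓 ∩ E`
(`𝔓.comap (E.integralClosureToAbsIntegers R)`).  By Herbrand's theorem these form a compatible
system, so `Γ_K^v` maps onto each `Gal(E/K)^v`.
Ref: Serre, *Local Fields*, Ch. IV §3, Remark 1 after Prop. 14; Deligne, *Les constantes des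
équations fonctionnelles* (1973), §2. [folklore] -/
def absUpperRamificationSubgroup (𝔓 : Ideal (absIntegers R K)) (v : ℝ) :
    Subgroup (absoluteGaloisGroup K) :=
  ⨅ (E : IntermediateField K (AlgebraicClosure K)) (_ : FiniteDimensional K E) (_ : Normal K E),
    (upperRamificationSubgroup (𝔓.comap (E.integralClosureToAbsIntegers R)) (E ≃ₐ[K] E) v).comap
      (absRestrictNormalHom E)

variable {R}

/-- Membership in `Γ_K^v`: for every finite normal `E/K` inside `K̄`, the restriction of `σ` to
`E` lies in `Gal(E/K)^v` (at `𝔓 ∩ E`).  Ref: Serre, *Local Fields*, Ch. IV §3, Remark 1. [folklore] -/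
theorem mem_absUpperRamificationSubgroup_iff {𝔓 : Ideal (absIntegers R K)} {v : ℝ}
    {σ : absoluteGaloisGroup K} :
    σ ∈ absUpperRamificationSubgroup R 𝔓 v ↔
      ∀ (E : IntermediateField K (AlgebraicClosure K)) [FiniteDimensional K E] [Normal K E],
        absRestrictNormalHom E σ ∈
          upperRamificationSubgroup (𝔓.comap (E.integralClosureToAbsIntegers R)) (E ≃ₐ[K] E) v := by
  simp only [absUpperRamificationSubgroup, Subgroup.mem_iInf, Subgroup.mem_comap]

variable (R) in
/-- The absolute upper-numbering filtration is decreasing in `v`.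
Ref: Serre, *Local Fields*, Ch. IV §3, Remark 1 and Prop. 14. [folklore] -/
def absUpperRamificationSubgroup_antitone : Prop :=
  ∀ (𝔓 : Ideal (absIntegers R K)),
    Antitone (absUpperRamificationSubgroup R 𝔓)

/- interim proof relied on results that are now named facts (D-0014); demoted to a fact by the M5 import, proof preserved:
:= by
  intro v w hvw
  refine iInf_mono fun E => iInf_mono fun hfd => iInf_mono fun hn => Subgroup.comap_mono ?_
  haveI := hfd
  exact upperRamificationSubgroup_antitone _ _ hvw
-/

variable (R) in
/-- `Γ_K^v ≤ I_𝔓` for every `v`: the absolute upper-numbering groups lie in the inertia group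
of `𝔓` (every algebraic integer lies in a finite normal subextension).
Ref: Serre, *Local Fields*, Ch. IV §3, Remark 1. [cite: SerreLocalFields1979, Ch. IV §3 Remark 1] -/
def absUpperRamificationSubgroup_le_inertia : Prop :=
  ∀ (𝔓 : Ideal (absIntegers R K)) (v : ℝ),
    absUpperRamificationSubgroup R 𝔓 v ≤ 𝔓.inertia (absoluteGaloisGroup K)

variable (R) in
/-- `Γ_K^0 = I_𝔓`: at `v = 0` (indeed for all `v ≤ 0`) the absolute upper-numbering group is the
inertia group of `𝔓` in `Gal(K̄/K)` (finite level: `G^0 = G_0 = I`, and inertia is compatible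
with restriction).  Ref: Serre, *Local Fields*, Ch. IV §3, Remark 1 and Ch. I §7, Prop. 22. [cite: SerreLocalFields1979, Ch. IV §3 Remark 1 and Ch. I §7 Prop. 22] -/
def absUpperRamificationSubgroup_zero_eq_inertia : Prop :=
  ∀ (𝔓 : Ideal (absIntegers R K)),
    absUpperRamificationSubgroup R 𝔓 0 = 𝔓.inertia (absoluteGaloisGroup K)

end Absolute

/-! ### Local fields: the upper-numbering filtration of `Gal(F̄/F)` -/

section Local

open Field ValuativeRel GaloisRepresentations.IsNonarchimedeanLocalField
open scoped Valued

variable (F : Type*) [Field F] [ValuativeRel F] [TopologicalSpace F] [IsNonarchimedeanLocalField F]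

/-- The upper-numbering filtration `I_F^v = Γ_F^v` (`v : ℝ`) of the absolute Galois group of a
non-archimedean local field `F`, at the canonical prime `𝔓 = absMaximalIdeal F` of
`absIntegers 𝒪[F] F` (item C4).  `absUpperInertia F 0 = absInertia F`
(`absUpperInertia_zero`); the groups `I_F^v`, `v > 0`, define the Swan conductor (item C10).
Ref: Serre, *Local Fields*, Ch. IV §3, Remark 1; Deligne, *Les constantes des équations
fonctionnelles* (1973), §2. [folklore] -/
abbrev absUpperInertia (v : ℝ) : Subgroup (absoluteGaloisGroup F) :=
  absUpperRamificationSubgroup 𝒪[F] (absMaximalIdeal F) v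

/-- `I_F^v` is decreasing in `v`.  Ref: Serre, *Local Fields*, Ch. IV §3. [folklore] -/
def absUpperInertia_antitone : Prop :=
  Antitone (absUpperInertia F)

/- interim proof relied on results that are now named facts (D-0014); demoted to a fact by the M5 import, proof preserved:
:=
  absUpperRamificationSubgroup_antitone 𝒪[F] (absMaximalIdeal F)
-/

/-- `I_F^0 = I_F`.  Ref: Serre, *Local Fields*, Ch. IV §3, Remark 1. [folklore] -/
def absUpperInertia_zero : Prop :=
  absUpperInertia F 0 = absInertia F

/- interim proof relied on results that are now named facts (D-0014); demoted to a fact by the M5 import, proof preserved: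
:=
  absUpperRamificationSubgroup_zero_eq_inertia 𝒪[F] (absMaximalIdeal F)
-/

/-- `I_F^v ≤ I_F` for all `v`.  Ref: Serre, *Local Fields*, Ch. IV §3. [folklore] -/
def absUpperInertia_le_absInertia : Prop :=
  ∀ (v : ℝ),
    absUpperInertia F v ≤ absInertia F

/- interim proof relied on results that are now named facts (D-0014); demoted to a fact by the M5 import, proof preserved:
:=
  absUpperRamificationSubgroup_le_inertia 𝒪[F] (absMaximalIdeal F) v
-/

end Local

end Literature.NumberTheory.GaloisRepresentations

/-! ### Discharge: the lower-numbering filtration is eventually trivial -/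

namespace Ideal

section EventuallyBot

variable {S : Type*} [CommRing S] (𝔓 : Ideal S) (G : Type*) [Group G] [MulSemiringAction G S]

/-- **Discharge of `Ideal.ramificationSubgroup_eventually_eq_bot`.**  For a finite group `G`
acting faithfully on a Noetherian domain `S` and a proper ideal `𝔓`, `G_i = 1` for `i ≫ 0`.
Proof (Serre's argument, with Krull's intersection theorem replacing the discrete valuation):
if `σ ≠ 1` then, the action being faithful, `σ • x ≠ x` for some `x`; since
`⋂ₙ 𝔓 ^ n = 0` (Mathlib's `Ideal.iInf_pow_eq_bot_of_isDomain`), `σ • x - x ∉ 𝔓 ^ n` for some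
`n`, whence `σ ∉ G_i` for all `i + 1 ≥ n`; as `G` is finite, the maximum of these bounds over
`σ ≠ 1` works (Serre: `G_i` is trivial once `i ≥ sup_{s ≠ 1} v_L(s(x) - x)`).
[cite: SerreLocalFields1979, Ch. IV §1 Prop. 1 (p. 62) and its proof] -/
theorem ramificationSubgroup_eventually_eq_bot_holds :
    𝔓.ramificationSubgroup_eventually_eq_bot G := by
  intro _ _ _ _ h𝔓
  -- Each `σ ≠ 1` eventually leaves the filtration.
  have key : ∀ σ : G, σ ≠ 1 → ∃ N : ℕ, ∀ i, N ≤ i → σ ∉ 𝔓.ramificationSubgroup G i := by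
    intro σ hσ
    obtain ⟨x, hx⟩ : ∃ x : S, σ • x ≠ x := by
      by_contra h
      push Not at h
      exact hσ (FaithfulSMul.eq_of_smul_eq_smul (fun x => (h x).trans (one_smul G x).symm))
    have hx' : σ • x - x ∉ ⨅ n : ℕ, 𝔓 ^ n := by
      rw [Ideal.iInf_pow_eq_bot_of_isDomain 𝔓 h𝔓, Ideal.mem_bot, sub_eq_zero]
      exact hx
    rw [Submodule.mem_iInf] at hx'
    push Not at hx'
    obtain ⟨n, hn⟩ := hx'
    refine ⟨n, fun i hi hmem => hn ?_⟩
    exact Ideal.pow_le_pow_right (show n ≤ i + 1 by omega) (hmem.2 x)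
  classical
  choose N hN using key
  haveI := Fintype.ofFinite G
  refine ⟨Finset.univ.sup fun σ => if h : σ = 1 then 0 else N σ h, fun i hi => ?_⟩
  rw [Subgroup.eq_bot_iff_forall]
  intro σ hσ
  by_contra h
  refine hN σ h i (le_trans ?_ hi) hσ
  have := Finset.le_sup (f := fun σ => if h : σ = 1 then 0 else N σ h) (Finset.mem_univ σ)
  simpa [h] using this

end EventuallyBot

end Ideal
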